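import Summits.NavierStokesRegularity.NavierStokesRegularity.Theses.PlaneEnergyCeiling
import Summits.NavierStokesRegularity.NavierStokesRegularity.Theorems.Target.Negative.EnergyClassLoadBearing
import Literature.Analysis.FluidPDE.NSQuasipotential

/-!
# `PlanarEnergyAPriori` (stmt-NavierStokesRegularity-16855): non-vacuity, and the finite-energy clause is load-bearing

Negative (support) lemmas for the crux `PlaneEnergyCeiling.PlanarEnergyAPriori` (refuter crux-attack,
cycle 1). The crux says: along every classical solution `(u, p)` of unforced Navier–Stokes on
`ℝ³ × [0,T)` that is Leray–Hopf from a rapidly decaying datum `u 0`, the planar kinetic energies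
`∫_{R({x₂ = c})} |u(t)|² dA` are bounded uniformly in `t < T`, `R`, `c`.

* `hypotheses_zero` / `conclusion_zero` — the three solution hypotheses are satisfiable (the rest
  state), and the rest state passes the crux with `M = 0`: the crux is neither vacuous nor refuted
  by the trivial flow.
* `planarEnergy_drift_eq_top` — the drift flow `u(t, x) = -log(1 - t) e₀`, `p = -a'(t)⟪e₀, x⟫` of
  `Theorems/Target/Negative/EnergyClassLoadBearing` (the parasitic family `u = b(t)`, `p = -b'(t)·x`
  of Koch–Nadirashvili–Seregin–Šverák 2009, §1 p. 3) has INFINITE planar kinetic energy through every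
  plane at every time `t ∈ (0, 1)` (a nonzero constant integrated over `ℝ²`).
* `planarEnergyAPriori_false_without_lerayHopf` — the crux with the hypothesis
  `IsLerayHopfOn T ν 0 (u 0) u` DELETED (everything else verbatim) is FALSE (drift flow, `ν = T = 1`,
  plane `{x₂ = 0}`, `t = 1/2`).
* `planarEnergyAPriori_false_without_energy` — even with `IsLerayHopfOn` WEAKENED to its first
  field, the pressure-free weak formulation `IsWeakNSSolutionOn T ν 0 (u 0) u`, the statement is
  FALSE (the drift flow is a weak solution: `isWeakNSSolutionOn_drift`): of the Leray–Hopf bundle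
  exactly the finite-energy clauses are load-bearing.
* `not_isLerayHopfOn_drift_of_planarEnergyAPriori` — sanity: the crux implies the drift flow is not
  Leray–Hopf from rest.

So any proof of the crux must use `u(t) ∈ L²` / the energy inequality — in the birth line this is
where weak–strong uniqueness enters `stub_decayPersistence`. Nothing here closes the item
(`--supports`). [folklore]
-/

noncomputable section

namespace Summit.NavierStokesRegularity.NavierStokesRegularity.Theorems.PlanarEnergyAPrioriNegative

open Set Filter Topology MeasureTheory Function
open scoped InnerProductSpace RealInnerProductSpace ENNReal
open Literature.Analysis.FluidPDE
open Summit.NavierStokesRegularity.NavierStokesRegularity.Theorems.Target.Negative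

/-! ## §0 Non-vacuity -/

/-- **Non-vacuity of the hypotheses**: `u ≡ 0`, `p ≡ 0` on `[0, T)` is classical and Leray–Hopf
from the (rapidly decaying) zero datum, for every viscosity and horizon. [folklore] -/
theorem hypotheses_zero (ν T : ℝ) :
    IsClassicalNSSolutionOn (Ico 0 T) ν 0 (0 : ℝ → EuclideanSpace ℝ (Fin 3) → EuclideanSpace ℝ (Fin 3)) 0 ∧
      IsLerayHopfOn T ν 0 ((0 : ℝ → EuclideanSpace ℝ (Fin 3) → EuclideanSpace ℝ (Fin 3)) 0) 0 ∧
      HasRapidSpatialDecay ((0 : ℝ → EuclideanSpace ℝ (Fin 3) → EuclideanSpace ℝ (Fin 3)) 0) :=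
  ⟨isClassicalNSSolutionOn_zero _ _, by simpa using isLerayHopfOn_zero (E := EuclideanSpace ℝ (Fin 3)) T ν,
    by simpa using hasRapidSpatialDecay_zero⟩

/-- **The rest state passes the crux** with the ceiling `M = 0`. [folklore] -/
theorem conclusion_zero (T : ℝ) :
    ∃ M : ℝ, ∀ t ∈ Ico 0 T, ∀ (R : EuclideanSpace ℝ (Fin 3) ≃ₗᵢ[ℝ] EuclideanSpace ℝ (Fin 3)) (c : ℝ),
      ∫⁻ y : EuclideanSpace ℝ (Fin 2),
        ‖(0 : ℝ → EuclideanSpace ℝ (Fin 3) → EuclideanSpace ℝ (Fin 3)) t (R (WithLp.toLp 2 ![y 0, y 1, c]))‖ₑ ^ 2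
        ≤ ENNReal.ofReal M :=
  ⟨0, fun t _ R c => by simp⟩

/-! ## §1 The drift flow has infinite planar energy -/

/-- The drift amplitude `-log(1 - t)` is nonzero for `t ∈ (0, 1)`. [folklore] -/
theorem driftAmp_ne_zero {t : ℝ} (ht : t ∈ Ioo (0 : ℝ) 1) : driftAmp t ≠ 0 := by
  have h1 : 0 < 1 - t := by linarith [ht.2]
  have h2 : 1 - t < 1 := by linarith [ht.1]
  have hlog : Real.log (1 - t) < 0 := Real.log_neg h1 h2
  simp only [driftAmp, ne_eq, neg_eq_zero]
  exact hlog.ne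

/-- **Infinite planar energy**: at every time `t ∈ (0, 1)` the drift flow has infinite planar
kinetic energy through every plane `R({x₂ = c})` (a nonzero constant integrated over `ℝ²`, which has
infinite Lebesgue measure). [folklore] -/
theorem planarEnergy_drift_eq_top {t : ℝ} (ht : t ∈ Ioo (0 : ℝ) 1)
    (R : EuclideanSpace ℝ (Fin 3) ≃ₗᵢ[ℝ] EuclideanSpace ℝ (Fin 3)) (c : ℝ) :
    ∫⁻ y : EuclideanSpace ℝ (Fin 2), ‖driftVel t (R (WithLp.toLp 2 ![y 0, y 1, c]))‖ₑ ^ 2 = ⊤ := by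
  have he : ‖e₀‖ₑ = 1 := by
    rw [← ofReal_norm, norm_e₀, ENNReal.ofReal_one]
  have hconst : ∀ y : EuclideanSpace ℝ (Fin 2),
      ‖driftVel t (R (WithLp.toLp 2 ![y 0, y 1, c]))‖ₑ ^ 2 = ‖driftAmp t‖ₑ ^ 2 := by
    intro y
    rw [show driftVel t (R (WithLp.toLp 2 ![y 0, y 1, c])) = driftAmp t • e₀ from rfl, enorm_smul, he,
      mul_one]
  simp_rw [hconst, lintegral_const]
  rw [measure_univ_of_isAddLeftInvariant]
  refine ENNReal.mul_top ?_
  simpa using driftAmp_ne_zero ht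

/-! ## §2 Load-bearing hypotheses -/

/-- **LOAD-BEARING (Leray–Hopf).** `PlanarEnergyAPriori` with the hypothesis
`IsLerayHopfOn T ν 0 (u 0) u` deleted (everything else verbatim) is FALSE: at `ν = 1`, `T = 1` the
drift flow is classical from the rapidly decaying zero datum, yet its planar energy through the
plane `{x₂ = 0}` at `t = 1/2` is `⊤ > ofReal M`. [folklore] -/
theorem planarEnergyAPriori_false_without_lerayHopf :
    ¬ (∀ (ν T : ℝ), 0 < ν → 0 < T → ∀ (u : ℝ → EuclideanSpace ℝ (Fin 3) → EuclideanSpace ℝ (Fin 3)) (p : ℝ → EuclideanSpace ℝ (Fin 3) → ℝ), Literature.Analysis.FluidPDE.IsClassicalNSSolutionOn (Set.Ico 0 T) ν 0 u p → Literature.Analysis.FluidPDE.HasRapidSpatialDecay (u 0) → ∃ M : ℝ, ∀ t ∈ Set.Ico 0 T, ∀ (R : EuclideanSpace ℝ (Fin 3) ≃ₗᵢ[ℝ] EuclideanSpace ℝ (Fin 3)) (c : ℝ), ∫⁻ y : EuclideanSpace ℝ (Fin 2), ‖u t (R (WithLp.toLp 2 ![y 0, y 1, c]))‖ₑ ^ 2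 ≤ ENNReal.ofReal M) := by
  intro h
  obtain ⟨M, hM⟩ := h 1 1 one_pos one_pos driftVel driftPres (isClassical_drift 1)
    (by rw [driftVel_zero]; exact hasRapidSpatialDecay_zero)
  have h1 := hM (1 / 2) ⟨by norm_num, by norm_num⟩ (LinearIsometryEquiv.refl ℝ _) 0
  rw [planarEnergy_drift_eq_top ⟨by norm_num, by norm_num⟩] at h1
  exact ENNReal.ofReal_ne_top (top_le_iff.1 h1)

/-- **LOAD-BEARING (finite energy).** `PlanarEnergyAPriori` with `IsLerayHopfOn T ν 0 (u 0) u`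
WEAKENED to its first field `IsWeakNSSolutionOn T ν 0 (u 0) u` (the pressure-free weak formulation;
all finite-energy clauses deleted) is FALSE: the drift flow is a weak solution from rest
(compactly supported solenoidal tests have zero mean). [folklore] -/
theorem planarEnergyAPriori_false_without_energy :
    ¬ (∀ (ν T : ℝ), 0 < ν → 0 < T → ∀ (u : ℝ → EuclideanSpace ℝ (Fin 3) → EuclideanSpace ℝ (Fin 3)) (p : ℝ → EuclideanSpace ℝ (Fin 3) → ℝ), Literature.Analysis.FluidPDE.IsClassicalNSSolutionOn (Set.Ico 0 T) ν 0 u p → Literature.Analysis.FluidPDE.IsWeakNSSolutionOn T ν 0 (u 0) u → Literature.Analysis.FluidPDE.HasRapidSpatialDecay (u 0) → ∃ M : ℝ, ∀ t ∈ Set.Ico 0 T, ∀ (R : EuclideanSpace ℝ (Fin 3) ≃ₗᵢ[ℝ] EuclideanSpace ℝ (Fin 3)) (c : ℝ), ∫⁻ y : EuclideanSpace ℝ (Fin 2), ‖u t (R (WithLp.toLp 2 ![y 0, y 1, c]))‖ₑ ^ 2 ≤ ENNReal.ofReal M) := by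
  intro h
  obtain ⟨M, hM⟩ := h 1 1 one_pos one_pos driftVel driftPres (isClassical_drift 1)
    (isWeakNSSolutionOn_drift 1) (by rw [driftVel_zero]; exact hasRapidSpatialDecay_zero)
  have h1 := hM (1 / 2) ⟨by norm_num, by norm_num⟩ (LinearIsometryEquiv.refl ℝ _) 0
  rw [planarEnergy_drift_eq_top ⟨by norm_num, by norm_num⟩] at h1
  exact ENNReal.ofReal_ne_top (top_le_iff.1 h1)

/-- Sanity, read against the crux as stated: IF the crux holds, the drift flow is NOT Leray–Hopf
from rest on `[0, 1)` at any positive viscosity (its only failure is infinite energy). [folklore] -/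
theorem not_isLerayHopfOn_drift_of_planarEnergyAPriori
    (h : Summit.NavierStokesRegularity.NavierStokesRegularity.Theses.PlaneEnergyCeiling.PlanarEnergyAPriori)
    {ν : ℝ} (hν : 0 < ν) : ¬ IsLerayHopfOn 1 ν 0 (driftVel 0) driftVel := by
  intro hLH
  obtain ⟨M, hM⟩ := h ν 1 hν one_pos driftVel driftPres (isClassical_drift ν) hLH
    (by rw [driftVel_zero]; exact hasRapidSpatialDecay_zero)
  have h1 := hM (1 / 2) ⟨by norm_num, by norm_num⟩ (LinearIsometryEquiv.refl ℝ _) 0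
  rw [planarEnergy_drift_eq_top ⟨by norm_num, by norm_num⟩] at h1
  exact ENNReal.ofReal_ne_top (top_le_iff.1 h1)

end Summit.NavierStokesRegularity.NavierStokesRegularity.Theorems.PlanarEnergyAPrioriNegative

end
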